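import Summits.CriticalPhenomena.SAWScalingLimit.Theses.SAWDefectDecoherence

/-!
# Sketch (crux-ideate, stmt-CriticalPhenomena-14004 `BoundaryClosureR`, round 1, ideator 2 — gen 2)

Typed first lemmas of the idea card `dressed-arrival-cauchy-transform` of this seat:

* `DiscreteCauchyPompeiu` — EXACT, provable now from DCS Lemma 1 (the vertex relation, proved in the
  tree): for every function `g : ℂ → ℂ` the `g`-weighted boundary sum of `F dz` over `∂Ω` equals the sum
  over vertices of the star sums against the increments `g(mid) - g(c_v)`; interior edges cancel in pairs,
  `g(c_v)·(vertex relation) = 0` is subtracted at every vertex.  With `g` holomorphic the right-hand side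
  starts at the conjugate-class (curl) defect `Σ_t (mid - c_v)² F(vt) ∝ T(v)`; with `∂̄g = πψ` (Cauchy
  transform of a bulk test function) its `∂̄`-part IS the target quantity `Σ_e ψ F(e)`.
* `AdmissiblePinnedFamily` — the frame of the repaired target `HexObservableLimitR` (both marked points
  conformally pinned), bundled once.
* `HolomorphicSumRule` — the load-bearing CONSEQUENCE the line extracts from
  `DefectDecoherence` + positive-mass profile bounds: the phase-dressed boundary arrival measure
  `ν_δ = (δ/F_δ(b_δ)) Σ_{e ∈ ∂Ω_δ} (mid e - c_v) F_δ(e) δ_{δ·mid e}` asymptotically annihilates every entire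
  test function vanishing at the discrete root ("asymptotic Cauchy theorem up to the boundary").
* `CauchyRepresentation` — the target functional equals `(6/π) ⟨ν_δ, g_ψ - g_ψ(δ·mid a_δ)⟩ + o(1)` with
  `g_ψ` the Cauchy transform of the bulk test function `ψ ∈ C²_c(Ω)` (constant `6/π = 2/(π ℓ²)`,
  `ℓ = 1/√3` the embedded edge length).
* `BoundaryArrivalTightness` — the positive-mass input that turns the representation into compactness:
  `|z - a|`-weighted total boundary arrival mass is `O(Z_δ(b_δ)/δ)`.

Nothing here is proved; every declaration is a `def … : Prop` and the file only has to elaborate.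
-/

noncomputable section

open scoped BigOperators ComplexConjugate Topology
open Filter Set MeasureTheory
open Literature.Probability.LatticeModels Literature.Probability.RandomPlanarGeometry
open Literature.Probability.RandomPlanarGeometry.SAW
open Summit.CriticalPhenomena.SAWScalingLimit.Theses.SAWDefectDecoherence

namespace Summit.CriticalPhenomena.SAWScalingLimit.Cruxes.BoundaryClosureR.Ideator2CauchySketch

/-- **Discrete Cauchy–Pompeiu / Stokes identity** (exact; finite algebra + DCS Lemma 1).  For a simply
connected hexagonal domain `Λ`, a boundary root `a ∈ ∂Ω`, the critical observable
`F = F_{x_c, 5/8}` and ANY `g : ℂ → ℂ`: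
`Σ_{v ∈ Λ} Σ_{t ∼ v, t ∉ Λ} (mid{v,t} - c_v) g(mid{v,t}) F({v,t})`
`  = Σ_{v ∈ Λ} Σ_{t ∼ v} (mid{v,t} - c_v) (g(mid{v,t}) - g(c_v)) F({v,t})`.
(The left side is the discrete `∮_{∂Ω} g F dz`, root edge included with `F(a) = 1`; on the right every
interior edge appears twice with opposite increments and the same `g(mid)`, and `g(c_v)` times the
vertex relation vanishes.) -/
def DiscreteCauchyPompeiu : Prop :=
  ∀ (Λ : Finset HexVertex), hexDomainSimplyConnected Λ →
  ∀ a ∈ hexDomainBoundary Λ, ∀ g : ℂ → ℂ,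
    let F : Sym2 HexVertex → ℂ := hexParafermionicObservable Λ a hexCriticalFugacity (5 / 8)
    (∑ v ∈ Λ, ∑ᶠ t ∈ {t : HexVertex | hexGraph.Adj v t ∧ t ∉ Λ},
        (hexMidpoint s(v, t) - hexCenter v) * g (hexMidpoint s(v, t)) * F s(v, t)) =
      ∑ v ∈ Λ, ∑ᶠ t ∈ {t : HexVertex | hexGraph.Adj v t},
        (hexMidpoint s(v, t) - hexCenter v) * (g (hexMidpoint s(v, t)) - g (hexCenter v)) * F s(v, t)

/-- The frame of the repaired target `HexObservableLimitR` (stmt-14003), bundled: a Dobrushin domain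
flat (horizontal half-plane piece) in the `ρ`-balls about BOTH marked points, an admissible family of
simply connected hexagonal domains that is the exact half-lattice `{row ≥ m_i(δ)}` inside those balls,
exhausts compacts, and whose boundary mid-edges `a δ`, `b δ` converge to the marked points. -/
def AdmissiblePinnedFamily (D : DobrushinDomain) (ρ : ℝ) (Λ : ℝ → Finset HexVertex)
    (m : Fin 2 → ℝ → ℤ) (a b : ℝ → Sym2 HexVertex) : Prop :=
  0 < ρ ∧
  (∀ i : Fin 2, D.carrier ∩ Metric.ball (D.pt i) ρ =
      {z : ℂ | (D.pt i).im < z.im} ∩ Metric.ball (D.pt i) ρ) ∧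
  (∀ᶠ δ : ℝ in 𝓝[>] 0, hexDomainSimplyConnected (Λ δ) ∧ a δ ∈ hexDomainBoundary (Λ δ) ∧
      b δ ∈ hexDomainBoundary (Λ δ) ∧
      (hexGraph.induce ((Λ δ : Finset HexVertex) : Set HexVertex)).Preconnected ∧
      (∀ v ∈ Λ δ, (δ : ℂ) * hexCenter v ∈ D.carrier) ∧
      (∀ i : Fin 2, ∀ v : HexVertex, (δ : ℂ) * hexCenter v ∈ Metric.ball (D.pt i) ρ →
        (v ∈ Λ δ ↔ m i δ ≤ v.1 1))) ∧
  (∀ K : Set ℂ, IsCompact K → K ⊆ D.carrier →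
      ∀ᶠ δ : ℝ in 𝓝[>] 0, ∀ v : HexVertex, (δ : ℂ) * hexCenter v ∈ K → v ∈ Λ δ) ∧
  Tendsto (fun δ : ℝ => (δ : ℂ) * hexMidpoint (a δ)) (𝓝[>] 0) (𝓝 (D.pt 0)) ∧
  Tendsto (fun δ : ℝ => (δ : ℂ) * hexMidpoint (b δ)) (𝓝[>] 0) (𝓝 (D.pt 1))

/-- The phase-dressed boundary functional `⟨ν_δ, G⟩ := (δ / F_δ(b_δ)) Σ_{v ∈ Λ_δ} Σ_{t ∼ v, t ∉ Λ_δ}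
G(δ·mid{v,t}) (mid{v,t} - c_v) F_δ({v,t})` — by boundary winding rigidity each term is a POSITIVE
arrival mass `Z_δ(e)` times the exact lattice phase `e^{i(3/8)W_e} e^{iθ_a} (ℓ/2)` times `G(δ e)`. -/
def dressedBoundaryFunctional (Λ : Finset HexVertex) (a b : Sym2 HexVertex) (δ : ℝ)
    (G : ℂ → ℂ) : ℂ :=
  ((δ : ℂ) / hexParafermionicObservable Λ a hexCriticalFugacity (5 / 8) b) *
    ∑ v ∈ Λ, ∑ᶠ t ∈ {t : HexVertex | hexGraph.Adj v t ∧ t ∉ Λ},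
      G ((δ : ℂ) * hexMidpoint s(v, t)) * (hexMidpoint s(v, t) - hexCenter v) *
        hexParafermionicObservable Λ a hexCriticalFugacity (5 / 8) s(v, t)

/-- **Holomorphic boundary sum rules (asymptotic Cauchy theorem up to `∂Ω`)** — the deliverable the
line extracts from `DefectDecoherence` (θ > 25/48 suffices) plus positive-mass layer profiles: for every
admissible pinned family and every ENTIRE `h`, the dressed boundary arrival measure tested against
`(z - δ·mid a_δ)²·h(z)` (vanishing to second order at the DISCRETE root, so that only the `|z - a|`-weighted
layer-mass profile is needed near the root) is `o(1)`:
`(δ/F_δ(b_δ)) Σ_{e ∈ ∂Ω_δ} (δ·mid e - δ·mid a_δ)² h(δ·mid e) (mid e - c_v) F_δ(e) → 0`.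
(With the extra near-root shell bound the same holds with a first-order zero; DCS's flux identity is the
EXACT rule `g ≡ 1`, where the root term `F(a) = 1` survives.) -/
def HolomorphicSumRule : Prop :=
  ∀ (D : DobrushinDomain) (ρ : ℝ) (Λ : ℝ → Finset HexVertex) (m : Fin 2 → ℝ → ℤ)
    (a b : ℝ → Sym2 HexVertex), AdmissiblePinnedFamily D ρ Λ m a b →
    ∀ h : ℂ → ℂ, Differentiable ℂ h →
      Tendsto (fun δ : ℝ => dressedBoundaryFunctional (Λ δ) (a δ) (b δ) δ
          (fun z => (z - (δ : ℂ) * hexMidpoint (a δ)) ^ 2 * h z))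
        (𝓝[>] 0) (𝓝 0)

/-- **Cauchy representation of the bulk functional** — the target quantity of `HexObservableLimitR`
is, up to `o(1)`, the dressed boundary functional of the Cauchy transform of the test function:
for `ψ ∈ C²_c(Ω)` and `g_ψ(ζ) := ∫ ψ(w)/(ζ - w) dA(w)` (so `∂̄ g_ψ = π ψ`; `g_ψ` is holomorphic near `∂Ω`),
`δ² Σ_e ψ(δ·mid e) F_δ(e) / F_δ(b_δ) - (6/π) ⟨ν_δ, g_ψ - g_ψ(a') - g_ψ'(a')(· - a')⟩ → 0`, `a' := δ·mid a_δ`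
(`6/π = 2/(π ℓ²)`, `ℓ² = 1/3`).  The remainder is the `∂g_ψ`-pairing of the vertex-star conjugate-class
defect over the WHOLE domain (bulk: `MassRatio`; collar and root region: layer-mass profiles) plus
`O(δ³ Σ |∇²g_ψ| Z)`. -/
def CauchyRepresentation : Prop :=
  ∀ (D : DobrushinDomain) (ρ : ℝ) (Λ : ℝ → Finset HexVertex) (m : Fin 2 → ℝ → ℤ)
    (a b : ℝ → Sym2 HexVertex), AdmissiblePinnedFamily D ρ Λ m a b →
    ∀ ψ : ℂ → ℂ, ContDiff ℝ 2 ψ → HasCompactSupport ψ → tsupport ψ ⊆ D.carrier →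
      let F : ℝ → Sym2 HexVertex → ℂ := fun δ z =>
        hexParafermionicObservable (Λ δ) (a δ) hexCriticalFugacity (5 / 8) z
      let g : ℂ → ℂ := fun ζ => ∫ w, ψ w / (ζ - w)
      Tendsto (fun δ : ℝ =>
          (δ : ℂ) ^ 2 * (∑ᶠ e ∈ hexDomainMidEdges (Λ δ), ψ ((δ : ℂ) * hexMidpoint e) * F δ e) /
              F δ (b δ) -
            (6 / Real.pi : ℂ) * dressedBoundaryFunctional (Λ δ) (a δ) (b δ) δ
              (fun ζ => g ζ - g ((δ : ℂ) * hexMidpoint (a δ)) -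
                deriv g ((δ : ℂ) * hexMidpoint (a δ)) * (ζ - (δ : ℂ) * hexMidpoint (a δ))))
        (𝓝[>] 0) (𝓝 0)

/-- **Boundary arrival tightness** (positive-mass input, spin `0`): the `|z - a|`-weighted total boundary
arrival mass of the critical SAW from `a_δ` is `O(Z_δ(b_δ)/δ)` — the dressed boundary measures
`(z - a) ν_δ` have bounded total variation, so their Cauchy transforms form a normal family on `Ω` and the
bulk field inherits local bounds (compactness and the `L¹` bound of the signal and curl channels). -/
def BoundaryArrivalTightness : Prop :=
  ∀ (D : DobrushinDomain) (ρ : ℝ) (Λ : ℝ → Finset HexVertex) (m : Fin 2 → ℝ → ℤ)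
    (a b : ℝ → Sym2 HexVertex), AdmissiblePinnedFamily D ρ Λ m a b →
    ∃ C : ℝ, ∀ᶠ δ : ℝ in 𝓝[>] 0,
      δ * ∑ v ∈ Λ δ, ∑ᶠ t ∈ {t : HexVertex | hexGraph.Adj v t ∧ t ∉ Λ δ},
          ‖(δ : ℂ) * hexMidpoint s(v, t) - (δ : ℂ) * hexMidpoint (a δ)‖ *
            ‖hexParafermionicObservable (Λ δ) (a δ) hexCriticalFugacity 0 s(v, t)‖ ≤
        C * ‖hexParafermionicObservable (Λ δ) (a δ) hexCriticalFugacity 0 (b δ)‖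

/-- Shape of the line (logic only, recorded so the file documents the intended composition):
the exact identity and the sum rules are CONSEQUENCES used inside the crux; the crux itself stays
`DefectDecoherence → MassRatio → HexObservableLimitR`. -/
def LineShape : Prop :=
  DiscreteCauchyPompeiu → (DefectDecoherence → MassRatio → HolomorphicSumRule ∧ CauchyRepresentation) →
    BoundaryArrivalTightness → BoundaryClosureR

end Summit.CriticalPhenomena.SAWScalingLimit.Cruxes.BoundaryClosureR.Ideator2CauchySketch

end
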